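import Summits.QuantumFields.YangMills.Theorems.BalabanLadderUVSeamRecClassicalResponseDefs
import HarnessLib

/-!
# Crux `UVSeamRec` (stmt-QuantumFields-20043): GAUGE INVARIANCE of the classical response carrier

Helper file (`--supports stmt-QuantumFields-20043`) of the LEAD seat `ym-spine-20043-p1` (gen 8); sequel of p546887 `…ClassicalResponseDefs.lean`,
which types the classical response `classicalResponse`/`carrierCl` of a cube and CLAIMS it is gauge-invariant.  This file proves the claim:
under a gauge transformation `η ↦ gaugeTransformZd g η` of the exterior (any site function `g : ℤ⁴ → G`, no continuity or smallness), the tilted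
cube minima `tiltedMin`, the classical response `classicalResponse` and the carrier `carrierCl` are UNCHANGED — so the (split-cl) law of the (β)
architecture (LEAD note #60 §6, `ClassicalResponse.SplitCl`) is a statement about gauge orbits of exteriors, as it must be for a law whose left side
`kerE(plane)(η)` is itself gauge-invariant (the Wilson specification is gauge-covariant and `plane` invariant).  This is the property a LINEAR
lattice-Poisson flux functional lacks for non-abelian `G` (tempered-d1 g1 MEMO §3(b)).

* `gaugeTransformZd_glueWith` — transforming a glued configuration = gluing the conjugated inner links into the transformed exterior;
* `glueWith_gaugeTransformZd`, `plane_gaugeTransformZd`, `tiltedAction_gaugeTransformZd` — `tiltedAction (g·η) ζ = tiltedAction η (g⁻¹·ζ·g)` (conjugated inner links);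
* `tiltedMin_gaugeTransformZd`, `classicalResponse_gaugeTransformZd`, `carrierCl_gaugeTransformZd` — invariance.

HONEST FRAMING: an elementary invariance property of a route-posited object; nothing of E0′; not a gap, not Clay.
-/

set_option autoImplicit false

noncomputable section

open MeasureTheory Filter Topology
open Literature.MathematicalPhysics.QuantumFieldTheory Literature.MathematicalPhysics.QuantumLattice
open Literature.Probability.LatticeModels
open Summit.QuantumFields.YangMills.Cruxes.OSLegsFromFemtoAndGap.DlrCollarTransfer
open Summit.QuantumFields.YangMills.Cruxes.NT.BoundaryLaw (plane_eq_plaquetteObs)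

namespace Summit.QuantumFields.YangMills.Cruxes.UVSeamRec.ClassicalResponse

variable {G : Type} [Group G] [TopologicalSpace G] [IsTopologicalGroup G] [CompactSpace G]
  [MeasurableSpace G] [BorelSpace G] (r : LatticeRep G)

/-! ## §1 Gauge transformations and gluing -/

omit [TopologicalSpace G] [IsTopologicalGroup G] [CompactSpace G] [MeasurableSpace G] [BorelSpace G] in
/-- **Gauge transform of a glued configuration** = glue the conjugated inner links into the transformed exterior. [folklore] -/
theorem gaugeTransformZd_glueWith (Λ : Finset (Literature.MathematicalPhysics.QuantumLattice.ZdEdge 4)) (g : Site 4 → G) (ζ : ↥Λ → G) (η : LGConfig 4 G) :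
    gaugeTransformZd g (glueWith Λ ζ η) =
      glueWith Λ (fun e => g e.1.1 * ζ e * (g (e.1.1 + Pi.single e.1.2 1))⁻¹) (gaugeTransformZd g η) := by
  funext e
  by_cases he : e ∈ Λ
  · simp [gaugeTransformZd, glueWith_apply_mem _ _ _ he]
  · simp [gaugeTransformZd, glueWith_apply_not_mem _ _ _ he]

omit [TopologicalSpace G] [IsTopologicalGroup G] [CompactSpace G] [MeasurableSpace G] [BorelSpace G] in
/-- Gluing `ζ` into a transformed exterior = transforming the glue of the back-conjugated links. [folklore] -/
theorem glueWith_gaugeTransformZd (Λ : Finset (Literature.MathematicalPhysics.QuantumLattice.ZdEdge 4)) (g : Site 4 → G) (ζ : ↥Λ → G) (η : LGConfig 4 G) :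
    glueWith Λ ζ (gaugeTransformZd g η) =
      gaugeTransformZd g (glueWith Λ (fun e => (g e.1.1)⁻¹ * ζ e * g (e.1.1 + Pi.single e.1.2 1)) η) := by
  rw [gaugeTransformZd_glueWith]
  congr 1
  funext e
  simp [mul_assoc]

omit [IsTopologicalGroup G] [CompactSpace G] [BorelSpace G] in
/-- The single-plane plaquette field is gauge-invariant. [folklore] -/
theorem plane_gaugeTransformZd (q : Fin 4 × Fin 4) (x : Fin 4 → ℤ) (g : Site 4 → G) (U : LGConfig 4 G) :
    plane G r q x (gaugeTransformZd g U) = plane G r q x U := by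
  rw [plane_eq_plaquetteObs G r, plane_eq_plaquetteObs G r]
  exact isZdGaugeInvariant_plaquetteObs r.ρ x q.1 q.2 g U

/-! ## §2 Invariance of the tilted minima, the classical response and the carrier -/

omit [IsTopologicalGroup G] [CompactSpace G] [BorelSpace G] in
/-- `tiltedAction (g·η) ζ = tiltedAction η (g⁻¹ ζ g)` — conjugated inner links (gauge invariance of the boundary Wilson action and of `plane`). [folklore] -/
theorem tiltedAction_gaugeTransformZd (c : Fin 4 → ℤ) (b : ℕ) (q : Fin 4 × Fin 4) (x : Fin 4 → ℤ) (s : ℝ) (g : Site 4 → G)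
    (η : LGConfig 4 G) (ζ : ↥(cubeEdges c b) → G) :
    tiltedAction r c b q x s (gaugeTransformZd g η) ζ =
      tiltedAction r c b q x s η (fun e => (g e.1.1)⁻¹ * ζ e * g (e.1.1 + Pi.single e.1.2 1)) := by
  simp only [tiltedAction]
  rw [glueWith_gaugeTransformZd, wilsonBoundaryAction_gaugeTransformZd, plane_gaugeTransformZd]

omit [IsTopologicalGroup G] [CompactSpace G] [BorelSpace G] in
/-- The set of tilted values over the fibre is gauge-invariant (the conjugation is a bijection of the fibre). [folklore] -/
theorem tiltedAction_image_gaugeTransformZd (c : Fin 4 → ℤ) (b : ℕ) (q : Fin 4 × Fin 4) (x : Fin 4 → ℤ) (s : ℝ) (g : Site 4 → G)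
    (η : LGConfig 4 G) :
    tiltedAction r c b q x s (gaugeTransformZd g η) '' Set.univ = tiltedAction r c b q x s η '' Set.univ := by
  ext t
  simp only [Set.image_univ, Set.mem_range]
  constructor
  · rintro ⟨ζ, rfl⟩
    exact ⟨fun e => (g e.1.1)⁻¹ * ζ e * g (e.1.1 + Pi.single e.1.2 1), (tiltedAction_gaugeTransformZd r c b q x s g η ζ).symm⟩
  · rintro ⟨ζ, rfl⟩
    refine ⟨fun e => g e.1.1 * ζ e * (g (e.1.1 + Pi.single e.1.2 1))⁻¹, ?_⟩
    rw [tiltedAction_gaugeTransformZd]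
    congr 1
    funext e
    simp [mul_assoc]

omit [IsTopologicalGroup G] [CompactSpace G] [BorelSpace G] in
/-- **The tilted cube minimum is gauge-invariant.** [folklore] -/
theorem tiltedMin_gaugeTransformZd (c : Fin 4 → ℤ) (b : ℕ) (q : Fin 4 × Fin 4) (x : Fin 4 → ℤ) (s : ℝ) (g : Site 4 → G)
    (η : LGConfig 4 G) : tiltedMin r c b q x s (gaugeTransformZd g η) = tiltedMin r c b q x s η := by
  unfold tiltedMin
  rw [tiltedAction_image_gaugeTransformZd]

omit [IsTopologicalGroup G] [CompactSpace G] [BorelSpace G] in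
/-- **The classical response is gauge-invariant.** [folklore] -/
theorem classicalResponse_gaugeTransformZd (c : Fin 4 → ℤ) (b : ℕ) (q : Fin 4 × Fin 4) (x : Fin 4 → ℤ) (s : ℝ) (g : Site 4 → G)
    (η : LGConfig 4 G) : classicalResponse r c b q x s (gaugeTransformZd g η) = classicalResponse r c b q x s η := by
  unfold classicalResponse
  rw [tiltedMin_gaugeTransformZd, tiltedMin_gaugeTransformZd]

omit [IsTopologicalGroup G] [CompactSpace G] [BorelSpace G] in
/-- **The classical carrier is gauge-invariant.** [folklore] -/
theorem carrierCl_gaugeTransformZd (C s β : ℝ) (R : ℕ) (q : Fin 4 × Fin 4) (x : Fin 4 → ℤ) (g : Site 4 → G) (η : LGConfig 4 G) :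
    carrierCl r C s β R q x (gaugeTransformZd g η) = carrierCl r C s β R q x η := by
  unfold carrierCl
  rw [classicalResponse_gaugeTransformZd]

end Summit.QuantumFields.YangMills.Cruxes.UVSeamRec.ClassicalResponse

end
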